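import Summits.NavierStokesRegularity.NavierStokesRegularity.Theorems.CoriolisHeadNoCoRotatingCoreOfLiouvilleConjectures
import Summits.NavierStokesRegularity.NavierStokesRegularity.Theorems.PoloidalWindowDoorOfNoLocalTypeI
import Summits.NavierStokesRegularity.NavierStokesRegularity.Theses.TypeILiouville
import Literature.Analysis.FluidPDE.LiouvilleExcludesLocalTypeI
import HarnessLib

/-!
# CoriolisHeadNoCoRotatingCoreOfNoLocalTypeI — crux `NoCoRotatingCore` (stmt-NavierStokesRegularity-22676) sits BELOW
# «no local Type-I singularity» (Albritton–Barker 2019, Thm 1.1) and hence below the hard core H2 (item 10661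
# `TypeILiouville.TypeIliouvilleL` = the Liouville conjecture (L)) BY ITEM NAME

Support file (`--supports stmt-NavierStokesRegularity-22676 --as helper`; theorems only, no definitions, no named-fact
hypotheses other than the registered OPEN statements it is conditional on).  Dictionary edges for the NS wall board,
refining the (L)-edge `noCoRotatingCore_of_liouvilleConjectureNS` (p653404):

* `nontrivialMildAncientTypeIExists_of_profile_ne_zero` — **a non-zero Pineau–Vicol-frame profile IS a Type-I blow-up
  profile**: for a smooth solution `(U, P)` of the rotating-frame profile system at ANY rate `α` (also `α = 0`) with the
  Type-I decay `‖U(y)‖ ≤ K/(1 + ‖y‖)` and `U(y₀) ≠ 0`, Albritton–Barker's second bullet `NontrivialMildAncientTypeIExists`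
  holds — the ansatz field is a Type-I ancient field in the KNSS mild gauge (`isTypeIAncientMild_pvAnsatz_of_profile`,
  p653404 §1), non-zero at `t = −1`, and K2-p2's `nontrivialMildAncientTypeIExists_of_class_ne_zero` (p648936) packages
  its past translate as a witness (slab pressure, weak gradient, `𝐈 < ∞`);
* `localTypeISingularityExists_of_profile_ne_zero` — hence, by the tree theorem
  `AlbrittonBarkerTypeICharacterization_holds` (A–B Thm 1.1), a suitable weak solution with a local Type-I singular point;
* `pineauVicolConjecture_of_not_localTypeISingularityExists`,
  **`noCoRotatingCore_of_not_localTypeISingularityExists : ¬ LocalTypeISingularityExists → CoriolisHead.NoCoRotatingCore`**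
  and **`noCoRotatingCore_of_not_nontrivialMildAncientTypeIExists`** — the crux (⟺ Pineau–Vicol Conj. 1.1, p650800)
  follows from Type-I exclusion in either of Albritton–Barker's two equivalent printed senses;
* **`noCoRotatingCore_of_typeIliouvilleL : TypeILiouville.TypeIliouvilleL → CoriolisHead.NoCoRotatingCore`** — the
  board edge **22676 ⟸ H2 (item 10661) by item name** (the item is definitionally the leaf (L); one line over p653404);
* `noCoRotatingCore_of_liouvilleConjectureNS'` — p653404's (L)-edge re-derived THROUGH «no local Type-I singularity»
  (`not_localTypeISingularityExists_of_liouvilleConjectureNS`), recording that the new edge refines the old one;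
* contrapositives `localTypeISingularityExists_of_not_noCoRotatingCore`,
  `nontrivialMildAncientTypeIExists_of_not_noCoRotatingCore`: a counterexample to the crux is a Type-I singularity.

So on the board: 22676 ⟸ «no local Type-I singularity» ⟸ (L) = H2, beside 22676 ⟸ Type-I DSS wall on
`[e^{π/α₂(K)}, e^{π/α₁(K)}]` (p653404/p653929) and 22676 ⟺ PV Conj. 1.1 (p650800).

HONEST FRAMING.  CONDITIONAL bridges between OPEN statements: `LocalTypeISingularityExists`,
`NontrivialMildAncientTypeIExists`, (L), `NoCoRotatingCore` and Pineau–Vicol's Conjecture 1.1 are all open; nothing here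
proves any of them, and nothing here proves or bears on Navier–Stokes regularity (Clay (A) OPEN).  Seat ns-ffc-k1 g7.

References: D. Albritton, T. Barker, Arch. Ration. Mech. Anal. 232 (2019), Thm 1.1 and §1 [AlbrittonBarker2019];
G. Koch, N. Nadirashvili, G. Seregin, V. Šverák, Acta Math. 203 (2009), §1 conjecture (L), Thm 6.1
[KochNadirashviliSereginSverak2009]; B. Pineau, V. Vicol, arXiv:2607.09619 (2026), Conj. 1.1 [PineauVicol2026].
-/

noncomputable section

-- the summit and its single sub-problem share the name (CONVENTIONS §1), as in every Theorems file
set_option linter.dupNamespace false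

open Set Function Filter MeasureTheory
open Literature.Analysis.FluidPDE Literature.Analysis.FluidPDE.PineauVicol2026
open Summit.NavierStokesRegularity.NavierStokesRegularity.Theses
open Summit.NavierStokesRegularity.NavierStokesRegularity.Theorems.PoloidalWindowDoorOfNoLocalTypeI
  (nontrivialMildAncientTypeIExists_of_class_ne_zero class_eq_zero_of_not_localTypeISingularityExists)
open scoped RealInnerProductSpace Laplacian ContDiff Topology

namespace Summit.NavierStokesRegularity.NavierStokesRegularity.Theorems.CoriolisHead

/-! ## §1 A non-zero profile is a Type-I blow-up profile (Albritton–Barker's second bullet, then the first) -/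

/-- **A non-zero rotating-frame profile with Type-I decay witnesses Albritton–Barker's second bullet.**  If `(U, P)` is
a smooth solution of the Pineau–Vicol-frame profile system at rate `α` with `‖U(y)‖ ≤ K/(1 + ‖y‖)` and `U(y₀) ≠ 0`,
then `NontrivialMildAncientTypeIExists`: the ansatz field `u = pvAnsatz α U` is a Type-I ancient field in the KNSS
mild gauge with `u(−1) = U`, so `u(−1, y₀) ≠ 0`, and a past translate of a non-zero member of that class is a
non-trivial bounded ancient mild solution with a slab pressure, a weak gradient and `𝐈 < ∞`.
[cite: AlbrittonBarker2019, Thm 1.1 (second bullet) and §1; KochNadirashviliSereginSverak2009, Thm 6.1] -/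
theorem nontrivialMildAncientTypeIExists_of_profile_ne_zero {α K : ℝ}
    {U : EuclideanSpace ℝ (Fin 3) → EuclideanSpace ℝ (Fin 3)} {P : EuclideanSpace ℝ (Fin 3) → ℝ}
    (hU : ContDiff ℝ (⊤ : ℕ∞) U) (hP : ContDiff ℝ 2 P) (hdiv : VectorCalculus.IsDivFree U)
    (heq : ∀ y, α • (rotGen (U y) - fderiv ℝ U y (rotGen y)) + (1 / 2 : ℝ) • U y
      + (1 / 2 : ℝ) • fderiv ℝ U y y - Laplacian.laplacian U y
      + Literature.Analysis.FluidPDE.convect U U y + gradient P y = 0)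
    (hdec : ∀ y, ‖U y‖ ≤ K / (1 + ‖y‖)) {y₀ : EuclideanSpace ℝ (Fin 3)} (hne : U y₀ ≠ 0) :
    NontrivialMildAncientTypeIExists := by
  set u : ℝ → EuclideanSpace ℝ (Fin 3) → EuclideanSpace ℝ (Fin 3) := pvAnsatz α (fun y _ => U y) with hu
  have hT : IsTypeIAncientMild K u := isTypeIAncientMild_pvAnsatz_of_profile hU hP hdiv heq hdec
  have hne' : u (-1) y₀ ≠ 0 := by rwa [hu, pvAnsatz_neg_one]
  exact nontrivialMildAncientTypeIExists_of_class_ne_zero hT.2.2.2 hT.continuousOn_uncurry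
    (fun s t hst ht x => hT.mild_eq_heatExtension hst ht x) hT.2.1 (by norm_num : (-1 : ℝ) < 0) hne'

/-- **A non-zero rotating-frame profile with Type-I decay yields a local Type-I singular point** of a suitable weak
solution (Albritton–Barker's first bullet), by `nontrivialMildAncientTypeIExists_of_profile_ne_zero` and the tree
theorem `AlbrittonBarkerTypeICharacterization_holds` (A–B Thm 1.1: the two bullets are equivalent).
[cite: AlbrittonBarker2019, Thm 1.1] -/
theorem localTypeISingularityExists_of_profile_ne_zero {α K : ℝ}
    {U : EuclideanSpace ℝ (Fin 3) → EuclideanSpace ℝ (Fin 3)} {P : EuclideanSpace ℝ (Fin 3) → ℝ}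
    (hU : ContDiff ℝ (⊤ : ℕ∞) U) (hP : ContDiff ℝ 2 P) (hdiv : VectorCalculus.IsDivFree U)
    (heq : ∀ y, α • (rotGen (U y) - fderiv ℝ U y (rotGen y)) + (1 / 2 : ℝ) • U y
      + (1 / 2 : ℝ) • fderiv ℝ U y y - Laplacian.laplacian U y
      + Literature.Analysis.FluidPDE.convect U U y + gradient P y = 0)
    (hdec : ∀ y, ‖U y‖ ≤ K / (1 + ‖y‖)) {y₀ : EuclideanSpace ℝ (Fin 3)} (hne : U y₀ ≠ 0) :
    LocalTypeISingularityExists :=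
  AlbrittonBarkerTypeICharacterization_holds.mpr
    (nontrivialMildAncientTypeIExists_of_profile_ne_zero hU hP hdiv heq hdec hne)

/-! ## §2 The crux below «no local Type-I singularity» -/

/-- **«No local Type-I singularity» ⇒ Pineau–Vicol's Conjecture 1.1 (profile form), at every rotation rate.**  If no
suitable weak solution has a local Type-I singular point (`¬ LocalTypeISingularityExists`), every smooth solution
`(U, P)` of the Pineau–Vicol-frame profile system at any rate `α` with Type-I decay `‖U(y)‖ ≤ K/(1 + ‖y‖)` vanishes
identically (contrapositive of `localTypeISingularityExists_of_profile_ne_zero`).  CONDITIONAL on an OPEN statement.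
[cite: AlbrittonBarker2019, Thm 1.1 and §1] -/
theorem pineauVicolConjecture_of_not_localTypeISingularityExists (hN : ¬ LocalTypeISingularityExists) :
    ∀ (α : ℝ) (U : EuclideanSpace ℝ (Fin 3) → EuclideanSpace ℝ (Fin 3)) (P : EuclideanSpace ℝ (Fin 3) → ℝ),
      ContDiff ℝ (⊤ : ℕ∞) U → ContDiff ℝ 2 P →
      Literature.Analysis.FluidPDE.VectorCalculus.IsDivFree U →
      (∀ y, α • (rotGen (U y) - fderiv ℝ U y (rotGen y)) + (1 / 2 : ℝ) • U y
        + (1 / 2 : ℝ) • fderiv ℝ U y y - Laplacian.laplacian U y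
        + Literature.Analysis.FluidPDE.convect U U y + gradient P y = 0) →
      (∃ K : ℝ, ∀ y, ‖U y‖ ≤ K / (1 + ‖y‖)) →
      ∀ y, U y = 0 := by
  intro α U P hU hP hdiv heq hdec y
  obtain ⟨K, hK⟩ := hdec
  by_contra hne
  exact hN (localTypeISingularityExists_of_profile_ne_zero hU hP hdiv heq hK hne)

/-- **Edge: crux 22676 sits below «no local Type-I singularity».**
`¬ LocalTypeISingularityExists → CoriolisHead.NoCoRotatingCore`, by
`pineauVicolConjecture_of_not_localTypeISingularityExists` and the landed composition
`noCoRotatingCore_of_pineauVicolConjecture` (p645767).  CONDITIONAL bridge between OPEN statements; proves neither side.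
[cite: AlbrittonBarker2019, Thm 1.1 and §1] -/
theorem noCoRotatingCore_of_not_localTypeISingularityExists (hN : ¬ LocalTypeISingularityExists) :
    CoriolisHead.NoCoRotatingCore :=
  noCoRotatingCore_of_pineauVicolConjecture fun α _ U P hU hP hdiv heq hdec =>
    pineauVicolConjecture_of_not_localTypeISingularityExists hN α U P hU hP hdiv heq hdec

/-- **Edge: crux 22676 sits below «no non-trivial mild bounded ancient solution with `𝐈 < ∞`»** (Albritton–Barker's
second bullet negated — the Type-I ancient Liouville statement), via `AlbrittonBarkerTypeICharacterization_holds`.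
CONDITIONAL bridge between OPEN statements. [cite: AlbrittonBarker2019, Thm 1.1] -/
theorem noCoRotatingCore_of_not_nontrivialMildAncientTypeIExists (hN : ¬ NontrivialMildAncientTypeIExists) :
    CoriolisHead.NoCoRotatingCore :=
  noCoRotatingCore_of_not_localTypeISingularityExists fun h =>
    hN (AlbrittonBarkerTypeICharacterization_holds.mp h)

/-! ## §3 The crux below the hard core H2 by item name, and the refinement of the (L)-edge -/

/-- **Edge 22676 ⟸ H2 by item name**: the route item `TypeILiouville.TypeIliouvilleL` (stmt-NavierStokesRegularity-10661,
definitionally the Liouville conjecture (L) of Koch–Nadirashvili–Seregin–Šverák) implies the crux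
`CoriolisHead.NoCoRotatingCore` (stmt-NavierStokesRegularity-22676) — one line over `noCoRotatingCore_of_liouvilleConjectureNS`
(p653404).  CONDITIONAL on the OPEN conjecture (L). [cite: KochNadirashviliSereginSverak2009, §1 conjecture (L)] -/
theorem noCoRotatingCore_of_typeIliouvilleL (hL : TypeILiouville.TypeIliouvilleL) : CoriolisHead.NoCoRotatingCore :=
  noCoRotatingCore_of_liouvilleConjectureNS fun u hu hmeas t ht => hL u hu hmeas t ht

/-- **The (L)-edge factors through «no local Type-I singularity»**: `LiouvilleConjectureNS → CoriolisHead.NoCoRotatingCore`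
re-derived as `noCoRotatingCore_of_not_localTypeISingularityExists ∘ not_localTypeISingularityExists_of_liouvilleConjectureNS`
(Albritton–Barker §1: «(L) excludes Type I singularities»), so the edge of §2 refines p653404's.  CONDITIONAL on (L).
[cite: AlbrittonBarker2019, §1 (paragraph after Thm 1.1); KochNadirashviliSereginSverak2009, §1] -/
theorem noCoRotatingCore_of_liouvilleConjectureNS'
    (hL : Summit.NavierStokesRegularity.NavierStokesRegularity.LiouvilleConjectureNS) :
    CoriolisHead.NoCoRotatingCore :=
  noCoRotatingCore_of_not_localTypeISingularityExists (not_localTypeISingularityExists_of_liouvilleConjectureNS hL)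

/-! ## §4 Contrapositives: a counterexample to the crux is a Type-I singularity -/

/-- **A counterexample to `NoCoRotatingCore` yields a local Type-I singular point** of a suitable weak solution
(contrapositive of `noCoRotatingCore_of_not_localTypeISingularityExists`). [cite: AlbrittonBarker2019, Thm 1.1] -/
theorem localTypeISingularityExists_of_not_noCoRotatingCore (h : ¬ CoriolisHead.NoCoRotatingCore) :
    LocalTypeISingularityExists := by
  by_contra hN
  exact h (noCoRotatingCore_of_not_localTypeISingularityExists hN)

/-- **A counterexample to `NoCoRotatingCore` yields a non-trivial mild bounded ancient solution with `𝐈 < ∞`**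
(contrapositive of `noCoRotatingCore_of_not_nontrivialMildAncientTypeIExists`). [cite: AlbrittonBarker2019, Thm 1.1] -/
theorem nontrivialMildAncientTypeIExists_of_not_noCoRotatingCore (h : ¬ CoriolisHead.NoCoRotatingCore) :
    NontrivialMildAncientTypeIExists := by
  by_contra hN
  exact h (noCoRotatingCore_of_not_nontrivialMildAncientTypeIExists hN)

end Summit.NavierStokesRegularity.NavierStokesRegularity.Theorems.CoriolisHead

end
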